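import Literature.Analysis.FluidPDE.WholeSpaceIBP
import Literature.Analysis.FluidPDE.SuitableWeak
import HarnessLib

/-!
# Seregin 2020, Lemma 2.2: spatial ball cut-offs for the excision of the singular axis set — L22-B, piece F3b.1

Seat ns-es-p1 g3 (INPUTS A1 / L22-B; cut owner ns-inputs-plan g5; kit `A1-L22B-F3.md`, F3c design of ns-in-ser-b).  On a step of the
excision schedule (`…Lemma22ExcisionSchedule`) the test function `Θ` is multiplied by the PRODUCT cut-off `∏_{i ∈ A} (1 - ψᵢ)` of the
ACTIVE balls, where `ψᵢ` is a fixed `C¹` bump of the ball `B(xᵢ, rᵢ)`: `ψᵢ = 1` on `B̄(xᵢ, 2rᵢ)`, `ψᵢ = 0` off `B(xᵢ, 4rᵢ)`,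
`‖Dψᵢ‖ ≤ C₀/rᵢ`.  This file provides

* `exists_ballBump_const` — the bumps `y ↦ cutoff (2ρ) (y - c)` (the tree's `cutoff`) and their absolute gradient constant `C₀`;
* the product cut-off: `contDiff_prodCut`, `prodCut_nonneg`, `prodCut_le_one`, `prodCut_eq_zero`, `prodCut_eq_one`,
  `norm_fderiv_prodCut_le` (`‖D∏(1-ψᵢ)‖ ≤ ∑ ‖Dψᵢ‖`), `fderiv_prodCut_eq_zero`, `tsupport_mul_prodCut_subset`;
* switching: `one_sub_prod_le_sum`, `abs_prod_sub_prod_le` (`|∏_A aᵢ - ∏_{A'} aᵢ| ≤ ∑_{A \ A'} (1-aᵢ) + ∑_{A' \ A} (1-aᵢ)` for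
  `aᵢ ∈ [0,1]`), `one_sub_sq_le_indicator` (`1 - (1-ψⱼ)² ≤ 1_{B(xⱼ,4rⱼ)}`).

All statements are about an ARBITRARY family `ψ` with the listed properties (obtained once from `exists_ballBump_const`).
WHAT THIS IS NOT: no energy estimate, nothing about Navier–Stokes; no summit statement is proved here. [Seregin2020 §3; NazarovUraltseva2012 §3]
-/

-- the problem directory repeats the summit name (D-0017); core's `dupNamespace` linter fires
set_option linter.dupNamespace false

noncomputable section

open MeasureTheory Set Function Filter Topology TopologicalSpace Metric
open scoped NNReal ENNReal

namespace Summit.NavierStokesRegularity.NavierStokesRegularity.Theorems.AxisymmetricKatoGlobal.EulerScaling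

open Literature.Analysis.FluidPDE

/-! ### The bumps -/

/-- **Ball bumps with an absolute gradient constant.** There is `C₀ > 0` such that for every centre `c` and radius `ρ > 0` the
function `ψ(y) = cutoff (2ρ) (y - c)` is `C¹`, takes values in `[0, 1]`, equals `1` on `B̄(c, 2ρ)`, vanishes off `B(c, 4ρ)`,
has `‖Dψ(y)‖ ≤ C₀/ρ` everywhere and `Dψ(y) = 0` off `B(c, 4ρ)` (there `ψ` attains its minimum). [folklore] -/
theorem exists_ballBump_const : ∃ C₀ : ℝ, 0 < C₀ ∧ ∀ (c : EuclideanSpace ℝ (Fin 3)) (ρ : ℝ), 0 < ρ →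
    ContDiff ℝ 1 (fun y => cutoff (2 * ρ) (y - c)) ∧
    (∀ y, 0 ≤ cutoff (2 * ρ) (y - c) ∧ cutoff (2 * ρ) (y - c) ≤ 1) ∧
    (∀ y ∈ closedBall c (2 * ρ), cutoff (2 * ρ) (y - c) = 1) ∧
    (∀ y, y ∉ ball c (4 * ρ) → cutoff (2 * ρ) (y - c) = 0) ∧
    (∀ y, ‖fderiv ℝ (fun y => cutoff (2 * ρ) (y - c)) y‖ ≤ C₀ / ρ) ∧
    (∀ y, y ∉ ball c (4 * ρ) → fderiv ℝ (fun y => cutoff (2 * ρ) (y - c)) y = 0) := by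
  obtain ⟨C, hC0, hC⟩ := exists_norm_fderiv_cutoff_le (E := EuclideanSpace ℝ (Fin 3))
  refine ⟨C + 1, by linarith, fun c ρ hρ => ?_⟩
  have h2ρ : 0 < 2 * ρ := by linarith
  have hcd : ContDiff ℝ 1 (fun y : EuclideanSpace ℝ (Fin 3) => cutoff (2 * ρ) (y - c)) :=
    (contDiff_cutoff (n := 1) (2 * ρ)).comp (contDiff_id.sub contDiff_const)
  have hzero : ∀ y, y ∉ ball c (4 * ρ) → cutoff (2 * ρ) (y - c) = 0 := by
    intro y hy
    rw [mem_ball, dist_eq_norm, not_lt] at hy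
    exact cutoff_eq_zero h2ρ (by linarith)
  refine ⟨hcd, fun y => ⟨cutoff_nonneg _ _, cutoff_le_one _ _⟩, fun y hy => ?_, hzero, fun y => ?_, fun y hy => ?_⟩
  · rw [mem_closedBall, dist_eq_norm] at hy
    exact cutoff_eq_one h2ρ hy
  · have e : fderiv ℝ (fun y : EuclideanSpace ℝ (Fin 3) => cutoff (2 * ρ) (y - c)) y = fderiv ℝ (cutoff (2 * ρ)) (y - c) := by
      have := fderiv_comp_add_right (𝕜 := ℝ) (f := cutoff (E := EuclideanSpace ℝ (Fin 3)) (2 * ρ)) (x := y) (-c)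
      simpa only [sub_eq_add_neg] using this
    rw [e]
    calc ‖fderiv ℝ (cutoff (2 * ρ)) (y - c)‖ ≤ C / (2 * ρ) := hC _ h2ρ _
      _ ≤ (C + 1) / ρ := by
          rw [div_le_div_iff₀ h2ρ hρ]; nlinarith
  · -- a minimum point of a differentiable function
    refine IsLocalMin.fderiv_eq_zero ?_
    refine Filter.Eventually.of_forall fun y' => ?_
    show cutoff (2 * ρ) (y - c) ≤ cutoff (2 * ρ) (y' - c)
    rw [hzero y hy]; exact cutoff_nonneg _ _

/-! ### The product cut-off `∏_{i ∈ A} (1 - ψᵢ)` -/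

/-- `∏_{i∈A}(1-ψᵢ)` is `C¹` for `C¹` bumps. [folklore] -/
theorem contDiff_prodCut {A : Finset ℕ} {ψ : ℕ → EuclideanSpace ℝ (Fin 3) → ℝ} (hψ : ∀ i ∈ A, ContDiff ℝ 1 (ψ i)) :
    ContDiff ℝ 1 (fun y => ∏ i ∈ A, (1 - ψ i y)) :=
  contDiff_prod fun i hi => contDiff_const.sub (hψ i hi)

/-- `0 ≤ ∏_{i∈A}(1-ψᵢ)` when `ψᵢ ≤ 1`. [folklore] -/
theorem prodCut_nonneg {A : Finset ℕ} {ψ : ℕ → EuclideanSpace ℝ (Fin 3) → ℝ} {y : EuclideanSpace ℝ (Fin 3)}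
    (h1 : ∀ i ∈ A, ψ i y ≤ 1) : 0 ≤ ∏ i ∈ A, (1 - ψ i y) :=
  Finset.prod_nonneg fun i hi => sub_nonneg.2 (h1 i hi)

/-- `∏_{i∈A}(1-ψᵢ) ≤ 1` when `0 ≤ ψᵢ ≤ 1`. [folklore] -/
theorem prodCut_le_one {A : Finset ℕ} {ψ : ℕ → EuclideanSpace ℝ (Fin 3) → ℝ} {y : EuclideanSpace ℝ (Fin 3)}
    (h0 : ∀ i ∈ A, 0 ≤ ψ i y) (h1 : ∀ i ∈ A, ψ i y ≤ 1) : ∏ i ∈ A, (1 - ψ i y) ≤ 1 :=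
  Finset.prod_le_one (fun i hi => sub_nonneg.2 (h1 i hi)) fun i hi => sub_le_self _ (h0 i hi)

/-- `∏_{i∈A}(1-ψᵢ)(y) = 0` when some active `ψᵢ(y) = 1` (so on `⋃_{i∈A} B̄(xᵢ, 2rᵢ)`). [folklore] -/
theorem prodCut_eq_zero {A : Finset ℕ} {ψ : ℕ → EuclideanSpace ℝ (Fin 3) → ℝ} {y : EuclideanSpace ℝ (Fin 3)} {i : ℕ}
    (hi : i ∈ A) (h : ψ i y = 1) : ∏ i ∈ A, (1 - ψ i y) = 0 :=
  Finset.prod_eq_zero hi (by rw [h, sub_self])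

/-- `∏_{i∈A}(1-ψᵢ)(y) = 1` when every active `ψᵢ(y) = 0` (so off `⋃_{i∈A} B(xᵢ, 4rᵢ)`). [folklore] -/
theorem prodCut_eq_one {A : Finset ℕ} {ψ : ℕ → EuclideanSpace ℝ (Fin 3) → ℝ} {y : EuclideanSpace ℝ (Fin 3)}
    (h : ∀ i ∈ A, ψ i y = 0) : ∏ i ∈ A, (1 - ψ i y) = 1 :=
  Finset.prod_eq_one fun i hi => by rw [h i hi, sub_zero]

/-- **`‖D∏_{i∈A}(1-ψᵢ)(y)‖ ≤ ∑_{i∈A} ‖Dψᵢ(y)‖`** for `C¹` bumps with values in `[0,1]` (Leibniz rule, every factor has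
modulus `≤ 1`). [folklore] -/
theorem norm_fderiv_prodCut_le {A : Finset ℕ} {ψ : ℕ → EuclideanSpace ℝ (Fin 3) → ℝ}
    (hψ : ∀ i ∈ A, ContDiff ℝ 1 (ψ i)) (h0 : ∀ i ∈ A, ∀ y, 0 ≤ ψ i y) (h1 : ∀ i ∈ A, ∀ y, ψ i y ≤ 1)
    (y : EuclideanSpace ℝ (Fin 3)) :
    ‖fderiv ℝ (fun y => ∏ i ∈ A, (1 - ψ i y)) y‖ ≤ ∑ i ∈ A, ‖fderiv ℝ (ψ i) y‖ := by
  classical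
  induction A using Finset.induction_on with
  | empty => simp
  | @insert j A hj ih =>
    have hψA : ∀ i ∈ A, ContDiff ℝ 1 (ψ i) := fun i hi => hψ i (Finset.mem_insert_of_mem hi)
    have h0A : ∀ i ∈ A, ∀ y, 0 ≤ ψ i y := fun i hi => h0 i (Finset.mem_insert_of_mem hi)
    have h1A : ∀ i ∈ A, ∀ y, ψ i y ≤ 1 := fun i hi => h1 i (Finset.mem_insert_of_mem hi)
    have hjm : j ∈ insert j A := Finset.mem_insert_self j A
    have e : (fun y => ∏ i ∈ insert j A, (1 - ψ i y)) = fun y => (1 - ψ j y) * ∏ i ∈ A, (1 - ψ i y) :=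
      funext fun y => Finset.prod_insert hj
    have hdj : DifferentiableAt ℝ (fun y => 1 - ψ j y) y :=
      (((hψ j hjm).differentiable one_ne_zero).differentiableAt).const_sub 1
    have hdP : DifferentiableAt ℝ (fun y => ∏ i ∈ A, (1 - ψ i y)) y :=
      ((contDiff_prodCut hψA).differentiable one_ne_zero).differentiableAt
    rw [e, fderiv_fun_mul hdj hdP, Finset.sum_insert hj]
    have hPabs : |∏ i ∈ A, (1 - ψ i y)| ≤ 1 :=
      abs_le.2 ⟨by linarith [prodCut_nonneg (A := A) (fun i hi => h1A i hi y)],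
        prodCut_le_one (fun i hi => h0A i hi y) (fun i hi => h1A i hi y)⟩
    have hjabs : |1 - ψ j y| ≤ 1 := abs_le.2 ⟨by linarith [h1 j hjm y], by linarith [h0 j hjm y]⟩
    have ej : fderiv ℝ (fun y => 1 - ψ j y) y = -fderiv ℝ (ψ j) y := fderiv_const_sub 1
    calc ‖(1 - ψ j y) • fderiv ℝ (fun y => ∏ i ∈ A, (1 - ψ i y)) y +
            (∏ i ∈ A, (1 - ψ i y)) • fderiv ℝ (fun y => 1 - ψ j y) y‖
        ≤ ‖(1 - ψ j y) • fderiv ℝ (fun y => ∏ i ∈ A, (1 - ψ i y)) y‖ +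
            ‖(∏ i ∈ A, (1 - ψ i y)) • fderiv ℝ (fun y => 1 - ψ j y) y‖ := norm_add_le _ _
      _ ≤ 1 * ‖fderiv ℝ (fun y => ∏ i ∈ A, (1 - ψ i y)) y‖ + 1 * ‖fderiv ℝ (ψ j) y‖ := by
          rw [norm_smul, norm_smul, ej, norm_neg, Real.norm_eq_abs, Real.norm_eq_abs]
          exact add_le_add (mul_le_mul_of_nonneg_right hjabs (norm_nonneg _))
            (mul_le_mul_of_nonneg_right hPabs (norm_nonneg _))
      _ ≤ ‖fderiv ℝ (ψ j) y‖ + ∑ i ∈ A, ‖fderiv ℝ (ψ i) y‖ := by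
          rw [one_mul, one_mul, add_comm]
          exact add_le_add le_rfl (ih hψA h0A h1A)

/-- `D∏_{i∈A}(1-ψᵢ)(y) = 0` when every active `Dψᵢ(y) = 0` (so off `⋃_{i∈A} B(xᵢ, 4rᵢ)`). [folklore] -/
theorem fderiv_prodCut_eq_zero {A : Finset ℕ} {ψ : ℕ → EuclideanSpace ℝ (Fin 3) → ℝ}
    (hψ : ∀ i ∈ A, ContDiff ℝ 1 (ψ i)) (h0 : ∀ i ∈ A, ∀ y, 0 ≤ ψ i y) (h1 : ∀ i ∈ A, ∀ y, ψ i y ≤ 1)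
    {y : EuclideanSpace ℝ (Fin 3)} (h : ∀ i ∈ A, fderiv ℝ (ψ i) y = 0) :
    fderiv ℝ (fun y => ∏ i ∈ A, (1 - ψ i y)) y = 0 := by
  have := norm_fderiv_prodCut_le hψ h0 h1 y
  rw [Finset.sum_eq_zero (fun i hi => by rw [h i hi, norm_zero])] at this
  exact norm_le_zero_iff.1 this

/-- **Support of the cut test function**: `tsupport (Θ · ∏_{i∈A}(1-ψᵢ)) ⊆ tsupport Θ ∩ {y | 2rᵢ ≤ dist y xᵢ for all i ∈ A}`
when `ψᵢ = 1` on `B̄(xᵢ, 2rᵢ)` (the compact, `S`-free set of the closed-step argument). [folklore] -/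
theorem tsupport_mul_prodCut_subset {A : Finset ℕ} {ψ : ℕ → EuclideanSpace ℝ (Fin 3) → ℝ}
    {x : ℕ → EuclideanSpace ℝ (Fin 3)} {r : ℕ → ℝ}
    (hone : ∀ i ∈ A, ∀ y ∈ closedBall (x i) (2 * r i), ψ i y = 1) (Θ : EuclideanSpace ℝ (Fin 3) → ℝ) :
    tsupport (fun y => Θ y * ∏ i ∈ A, (1 - ψ i y)) ⊆ tsupport Θ ∩ {y | ∀ i ∈ A, 2 * r i ≤ dist y (x i)} := by
  refine subset_inter tsupport_mul_subset_left (tsupport_mul_subset_right.trans ?_)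
  refine closure_minimal ?_ ?_
  · intro y hy i hi
    by_contra h
    exact hy (prodCut_eq_zero hi (hone i hi y (mem_closedBall.2 (le_of_lt (lt_of_not_ge h)))))
  · have e : {y : EuclideanSpace ℝ (Fin 3) | ∀ i ∈ A, 2 * r i ≤ dist y (x i)} =
        ⋂ i ∈ A, {y | 2 * r i ≤ dist y (x i)} := by
      ext y; simp only [mem_setOf_eq, mem_iInter]
    rw [e]
    exact isClosed_biInter fun i _ => isClosed_le continuous_const (continuous_id.dist continuous_const)

/-- The cut test function has compact support and is `C¹`. [folklore] -/
theorem contDiff_hasCompactSupport_mul_prodCut {A : Finset ℕ} {ψ : ℕ → EuclideanSpace ℝ (Fin 3) → ℝ}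
    (hψ : ∀ i ∈ A, ContDiff ℝ 1 (ψ i)) {Θ : EuclideanSpace ℝ (Fin 3) → ℝ} (hΘ : ContDiff ℝ 1 Θ)
    (hΘc : HasCompactSupport Θ) :
    ContDiff ℝ 1 (fun y => Θ y * ∏ i ∈ A, (1 - ψ i y)) ∧ HasCompactSupport (fun y => Θ y * ∏ i ∈ A, (1 - ψ i y)) :=
  ⟨hΘ.mul (contDiff_prodCut hψ), hΘc.mul_right⟩

/-! ### Switching balls on and off -/

/-- `1 - ∏_{i∈D} aᵢ ≤ ∑_{i∈D} (1 - aᵢ)` for `aᵢ ∈ [0, 1]`. [folklore] -/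
theorem one_sub_prod_le_sum {ι : Type*} (D : Finset ι) (a : ι → ℝ) (h : ∀ i ∈ D, 0 ≤ a i ∧ a i ≤ 1) :
    1 - ∏ i ∈ D, a i ≤ ∑ i ∈ D, (1 - a i) := by
  classical
  induction D using Finset.induction_on with
  | empty => simp
  | @insert j D hj ih =>
    have hD : ∀ i ∈ D, 0 ≤ a i ∧ a i ≤ 1 := fun i hi => h i (Finset.mem_insert_of_mem hi)
    rw [Finset.prod_insert hj, Finset.sum_insert hj]
    have hP1 : ∏ i ∈ D, a i ≤ 1 := Finset.prod_le_one (fun i hi => (hD i hi).1) fun i hi => (hD i hi).2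
    have hj01 := h j (Finset.mem_insert_self j D)
    nlinarith [ih hD, mul_nonneg (sub_nonneg.2 hj01.2) (sub_nonneg.2 hP1)]

/-- **Switching bound**: `|∏_{i∈A} aᵢ - ∏_{i∈A'} aᵢ| ≤ ∑_{i∈A \ A'} (1 - aᵢ) + ∑_{i∈A' \ A} (1 - aᵢ)` for `aᵢ ∈ [0,1]`
(the common factor has modulus `≤ 1`; then `one_sub_prod_le_sum`).  With `aᵢ = (1-ψᵢ(y))²` and `one_sub_sq_le_indicator`
this bounds the jump of the cut mass at a junction by the volumes of the balls switched there. [folklore] -/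
theorem abs_prod_sub_prod_le {ι : Type*} [DecidableEq ι] (A A' : Finset ι) (a : ι → ℝ)
    (h : ∀ i ∈ A ∪ A', 0 ≤ a i ∧ a i ≤ 1) :
    |∏ i ∈ A, a i - ∏ i ∈ A', a i| ≤ ∑ i ∈ A \ A', (1 - a i) + ∑ i ∈ A' \ A, (1 - a i) := by
  have hA : ∀ i ∈ A, 0 ≤ a i ∧ a i ≤ 1 := fun i hi => h i (Finset.mem_union_left _ hi)
  have hA' : ∀ i ∈ A', 0 ≤ a i ∧ a i ≤ 1 := fun i hi => h i (Finset.mem_union_right _ hi)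
  have e1 : A \ (A ∩ A') = A \ A' := by
    ext i; simp only [Finset.mem_sdiff, Finset.mem_inter, not_and]; tauto
  have e2 : A' \ (A ∩ A') = A' \ A := by
    ext i; simp only [Finset.mem_sdiff, Finset.mem_inter, not_and']; tauto
  have eA : ∏ i ∈ A, a i = (∏ i ∈ A \ A', a i) * ∏ i ∈ A ∩ A', a i := by
    rw [← Finset.prod_sdiff Finset.inter_subset_left, e1]
  have eA' : ∏ i ∈ A', a i = (∏ i ∈ A' \ A, a i) * ∏ i ∈ A ∩ A', a i := by
    rw [← Finset.prod_sdiff Finset.inter_subset_right, e2]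
  have b01 : ∀ D : Finset ι, (∀ i ∈ D, 0 ≤ a i ∧ a i ≤ 1) → 0 ≤ ∏ i ∈ D, a i ∧ ∏ i ∈ D, a i ≤ 1 := fun D hD =>
    ⟨Finset.prod_nonneg fun i hi => (hD i hi).1, Finset.prod_le_one (fun i hi => (hD i hi).1) fun i hi => (hD i hi).2⟩
  obtain ⟨hQ0, hQ1⟩ := b01 (A ∩ A') fun i hi => hA i (Finset.mem_of_mem_inter_left hi)
  obtain ⟨hX0, hX1⟩ := b01 (A \ A') fun i hi => hA i (Finset.mem_sdiff.1 hi).1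
  obtain ⟨hY0, hY1⟩ := b01 (A' \ A) fun i hi => hA' i (Finset.mem_sdiff.1 hi).1
  have hX := one_sub_prod_le_sum (A \ A') a fun i hi => hA i (Finset.mem_sdiff.1 hi).1
  have hY := one_sub_prod_le_sum (A' \ A) a fun i hi => hA' i (Finset.mem_sdiff.1 hi).1
  rw [eA, eA', ← sub_mul, abs_mul, abs_of_nonneg hQ0]
  calc |∏ i ∈ A \ A', a i - ∏ i ∈ A' \ A, a i| * ∏ i ∈ A ∩ A', a i
      ≤ |∏ i ∈ A \ A', a i - ∏ i ∈ A' \ A, a i| * 1 := mul_le_mul_of_nonneg_left hQ1 (abs_nonneg _)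
    _ ≤ (1 - ∏ i ∈ A \ A', a i) + (1 - ∏ i ∈ A' \ A, a i) := by
        rw [mul_one]; exact abs_sub_le_iff.2 ⟨by linarith, by linarith⟩
    _ ≤ _ := add_le_add hX hY

/-- `0 ≤ 1 - (1-ψⱼ(y))² ≤ 1_{B(c,ρ)}(y)` for a bump with values in `[0,1]` vanishing off `B(c, ρ)`. [folklore] -/
theorem one_sub_sq_le_indicator {ψj : EuclideanSpace ℝ (Fin 3) → ℝ} {c : EuclideanSpace ℝ (Fin 3)} {ρ : ℝ}
    (h0 : ∀ y, 0 ≤ ψj y) (h1 : ∀ y, ψj y ≤ 1) (hz : ∀ y, y ∉ ball c ρ → ψj y = 0) (y : EuclideanSpace ℝ (Fin 3)) :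
    0 ≤ 1 - (1 - ψj y) ^ 2 ∧ 1 - (1 - ψj y) ^ 2 ≤ (ball c ρ).indicator (fun _ => (1 : ℝ)) y := by
  refine ⟨by nlinarith [h0 y, h1 y], ?_⟩
  by_cases hy : y ∈ ball c ρ
  · rw [indicator_of_mem hy]; nlinarith [h0 y, h1 y]
  · rw [indicator_of_notMem hy, hz y hy]; norm_num

/-- `0 ≤ (1-ψⱼ(y))² ≤ 1` for a bump with values in `[0,1]` (the factors fed to `abs_prod_sub_prod_le`). [folklore] -/
theorem one_sub_sq_mem_unitInterval {ψj : EuclideanSpace ℝ (Fin 3) → ℝ} (h0 : ∀ y, 0 ≤ ψj y) (h1 : ∀ y, ψj y ≤ 1)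
    (y : EuclideanSpace ℝ (Fin 3)) : 0 ≤ (1 - ψj y) ^ 2 ∧ (1 - ψj y) ^ 2 ≤ 1 :=
  ⟨sq_nonneg _, by nlinarith [h0 y, h1 y]⟩

end Summit.NavierStokesRegularity.NavierStokesRegularity.Theorems.AxisymmetricKatoGlobal.EulerScaling

end
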